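import Literature.Probability.LatticeModels.HoleFreePotential
import Mathlib.Combinatorics.SimpleGraph.Walk.Subwalks
import HarnessLib

/-!
# Unforced passages of a lattice walk through an annular collar

Support file for stub `stub_killedWalkCollarBound` (line `excursion-domination`, crux `FKGToTraversalBound`,
stmt-CriticalPhenomena-1878, route `SAWLeftRightFKG`): the TOPOLOGICAL half of the reduction of the
killed-walk collar bound to the random-walk dead-end estimate of Kemppainen–Smirnov (Ann. Probab. 45
(2017), Thm. 4.12 with Prop. 2.5), stated as the named fact `KemppainenSmirnov2017_rwDeadEndBound` in
the companion file `…KilledWalkCollarBound.lean`.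

Setting (the clauses of the registered signature, def-free): a finite `Λ ⊆ ℤ²`, a collar `V`, the
annulus `r ≤ |δx - z₀| ≤ R` (mesh `δ > 0`), the sites `Near` joined to `a` by lattice walks in `Λ` off
`V` (among them `b`), a set `H` missing `Near ∪ V`; a site is FAR when it is joined off `V` to a site of
`H`. Either every `Λ`-edge from `V` into `Near` lands at radius `< r` and every `Λ`-edge from `V` into
a far site lands at radius `> R`, or the other way round. Main result `exists_unforced_passage` (§4):
if `r + 2δ ≤ R`, every lattice walk in `Λ` from `a` to a site of `H` has a SUB-WALK running from within
`δ` of one circle to within `δ` of the other whose sites lie in `Λ ∩ {r ≤ |δx - z₀| ≤ R}` and are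
AVOIDABLE (Kemppainen–Smirnov 2017, Def. 2.2): the walk from `a` to `b` off `V` meets no site joined to
them inside `Λ ∩` annulus (last visit to `Near` before the first far site; passage extraction for a
real sequence with steps `≤ δ`; closure of `Λ ∖ (Near ∪ Far)` under lattice adjacency inside the
annulus). Fully proved, no named fact; consumers `…KilledWalkCollarDetour.lean`, `…KilledWalkCollarBound.lean`. [folklore]
-/

noncomputable section

open SimpleGraph
open Literature.Probability.LatticeModels

namespace Summit.CriticalPhenomena.SAWScalingLimit.Theorems.FKGToTraversalBound.ExcursionDomination.KilledWalkCollar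

/-! ## §1 Mesh geometry: one lattice step moves the mesh point by `δ` -/

/-- Mesh points of `ℤ²`-neighbours are at distance at most `δ` (`δ > 0`; in fact exactly `δ`).
[folklore] -/
theorem dist_meshPoint_le_of_adj {δ : ℝ} (hδ : 0 < δ) {x y : Site 2} (h : (zdGraph 2).Adj x y) :
    dist (meshPoint δ x) (meshPoint δ y) ≤ δ := by
  have key : ∀ (u : Site 2) (i : Fin 2),
      dist (meshPoint δ u) (meshPoint δ (u + Pi.single i 1)) ≤ δ := by
    intro u i
    rw [_root_.dist_comm, dist_eq_norm]
    have hre : (meshPoint δ (u + Pi.single i 1) - meshPoint δ u).re =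
        δ * ((Pi.single i (1 : ℤ) : Site 2) 0 : ℤ) := by
      simp only [Complex.sub_re, meshPoint_re, Pi.add_apply, Int.cast_add]; ring
    have him : (meshPoint δ (u + Pi.single i 1) - meshPoint δ u).im =
        δ * ((Pi.single i (1 : ℤ) : Site 2) 1 : ℤ) := by
      simp only [Complex.sub_im, meshPoint_im, Pi.add_apply, Int.cast_add]; ring
    have hsq : ‖meshPoint δ (u + Pi.single i 1) - meshPoint δ u‖ ^ 2 = δ ^ 2 := by
      rw [Complex.sq_norm, Complex.normSq_apply, hre, him]
      fin_cases i <;> simp [sq]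
    rw [← Real.sqrt_sq (norm_nonneg _), hsq, Real.sqrt_sq hδ.le]
  obtain ⟨i, h | h⟩ := (zdGraph_adj_iff x y).1 h
  · rw [h]; exact key x i
  · rw [h, _root_.dist_comm]; exact key y i

/-- Along a lattice step the distance of the mesh point from a fixed centre changes by at most
`δ`. [folklore] -/
theorem abs_dist_sub_dist_le_of_adj {δ : ℝ} (hδ : 0 < δ) (z₀ : ℂ) {x y : Site 2}
    (h : (zdGraph 2).Adj x y) :
    |dist (meshPoint δ y) z₀ - dist (meshPoint δ x) z₀| ≤ δ := by
  have h2 := dist_meshPoint_le_of_adj hδ h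
  rw [_root_.dist_comm] at h2
  exact (abs_dist_sub_le (meshPoint δ y) (meshPoint δ x) z₀).trans h2

/-! ## §2 Joins off a set of sites -/

section Joined

variable {Λ V : Finset (Site 2)} {u v w : Site 2}

/-- A site of `Λ ∖ V` is joined to itself. [folklore] -/
theorem joined_refl (hu : u ∈ Λ ∧ u ∉ V) : (∃ p : (zdGraph 2).Walk u u, ∀ x ∈ p.support, x ∈ Λ ∧ x ∉ V) :=
  ⟨Walk.nil, fun x hx => by rw [Walk.support_nil, List.mem_singleton] at hx; rw [hx]; exact hu⟩

/-- Transitivity of joins. [folklore] -/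
theorem joined_trans (h₁ : (∃ p : (zdGraph 2).Walk u v, ∀ x ∈ p.support, x ∈ Λ ∧ x ∉ V)) (h₂ : (∃ p : (zdGraph 2).Walk v w, ∀ x ∈ p.support, x ∈ Λ ∧ x ∉ V)) : (∃ p : (zdGraph 2).Walk u w, ∀ x ∈ p.support, x ∈ Λ ∧ x ∉ V) := by
  obtain ⟨p, hp⟩ := h₁
  obtain ⟨q, hq⟩ := h₂
  refine ⟨p.append q, fun x hx => ?_⟩
  rw [Walk.support_append, List.mem_append] at hx
  exact hx.elim (hp x) fun hx => hq x (List.mem_of_mem_tail hx)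

/-- The start of a join lies in `Λ ∖ V`. [folklore] -/
theorem mem_of_joined_left (h : (∃ p : (zdGraph 2).Walk u v, ∀ x ∈ p.support, x ∈ Λ ∧ x ∉ V)) : u ∈ Λ ∧ u ∉ V :=
  h.elim fun p hp => hp u p.start_mem_support

/-- The end of a join lies in `Λ ∖ V`. [folklore] -/
theorem mem_of_joined_right (h : (∃ p : (zdGraph 2).Walk u v, ∀ x ∈ p.support, x ∈ Λ ∧ x ∉ V)) : v ∈ Λ ∧ v ∉ V :=
  h.elim fun p hp => hp v p.end_mem_support

/-- Adjacent sites of `Λ ∖ V` are joined. [folklore] -/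
theorem joined_of_adj (hu : u ∈ Λ ∧ u ∉ V) (hv : v ∈ Λ ∧ v ∉ V) (h : (zdGraph 2).Adj u v) :
    (∃ p : (zdGraph 2).Walk u v, ∀ x ∈ p.support, x ∈ Λ ∧ x ∉ V) := by
  refine ⟨Walk.cons h Walk.nil, fun x hx => ?_⟩
  rw [Walk.support_cons, Walk.support_nil, List.mem_cons, List.mem_singleton] at hx
  rcases hx with rfl | rfl; exacts [hu, hv]

/-- Every site of a walk in `Λ ∖ V` is joined to its start. [folklore] -/
theorem joined_of_mem_support (p : (zdGraph 2).Walk u v) (hp : ∀ x ∈ p.support, x ∈ Λ ∧ x ∉ V)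
    {y : Site 2} (hy : y ∈ p.support) : (∃ p : (zdGraph 2).Walk u y, ∀ x ∈ p.support, x ∈ Λ ∧ x ∉ V) := by
  classical exact ⟨p.takeUntil y hy, fun x hx => hp x (p.support_takeUntil_subset_support hy hx)⟩

end Joined

/-! ## §3 A real sequence with steps `≤ δ` crossing `[r, R]` has a passage inside `[r, R]` -/

/-- **Passage extraction.** A real sequence with increments at most `δ` on `[l, m)` which is `< r`
at `l` and `> R` at `m` (`r + 2δ ≤ R`) has indices `l < i ≤ j < m` with `f i < r + δ`,
`R - δ < f j` and `r ≤ f k ≤ R` for `i ≤ k ≤ j`: the last visit below `r + δ` and the first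
subsequent visit above `R - δ`. [folklore] -/
theorem exists_passage {f : ℕ → ℝ} {δ r R : ℝ} (hδ : 0 < δ) (hrR : r + 2 * δ ≤ R) {l m : ℕ}
    (hlm : l < m) (hstep : ∀ k, l ≤ k → k < m → |f (k + 1) - f k| ≤ δ) (hl : f l < r)
    (hm : R < f m) :
    ∃ i j : ℕ, l < i ∧ i ≤ j ∧ j < m ∧ f i < r + δ ∧ R - δ < f j ∧
      ∀ k, i ≤ k → k ≤ j → r ≤ f k ∧ f k ≤ R := by
  classical
  have hst : ∀ k, l ≤ k → k < m → f (k + 1) ≤ f k + δ ∧ f k - δ ≤ f (k + 1) := fun k h1 h2 => by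
    have := hstep k h1 h2; rw [abs_le] at this; constructor <;> linarith [this.1, this.2]
  have hm2 : l + 2 ≤ m := by
    by_contra hlt
    have := (hst l le_rfl hlm).1
    rw [show l + 1 = m by omega] at this
    linarith
  set i := Nat.findGreatest (fun k => f k < r + δ) (m - 1) with hi
  have hl1 : f (l + 1) < r + δ := by linarith [(hst l le_rfl hlm).1]
  have hli : l + 1 ≤ i := Nat.le_findGreatest (by omega) hl1
  have him : i ≤ m - 1 := Nat.findGreatest_le (m - 1)
  have hfi : f i < r + δ := Nat.findGreatest_spec (P := fun k => f k < r + δ) (by omega) hl1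
  have himax : ∀ k, i < k → k ≤ m - 1 → r + δ ≤ f k := fun k hk hkm =>
    not_lt.1 (Nat.findGreatest_is_greatest hk hkm)
  have hex : ∃ k, i ≤ k ∧ R - δ < f k := by
    refine ⟨m - 1, him, ?_⟩
    have := (hst (m - 1) (by omega) (by omega)).1
    rw [Nat.sub_add_cancel (by omega)] at this
    linarith
  set j := Nat.find hex with hj
  have hij : i ≤ j := (Nat.find_spec hex).1
  have hfj : R - δ < f j := (Nat.find_spec hex).2
  have hjm : j ≤ m - 1 := by
    refine Nat.find_min' hex ⟨him, ?_⟩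
    have := (hst (m - 1) (by omega) (by omega)).1
    rw [Nat.sub_add_cancel (by omega)] at this
    linarith
  have hjmin : ∀ k, i ≤ k → k < j → f k ≤ R - δ := fun k hk hkj => by
    have := Nat.find_min hex hkj
    push Not at this
    exact this hk
  have hij' : i < j := hij.lt_or_eq.elim id fun h => by rw [← h] at hfj; linarith
  refine ⟨i, j, hli, hij, by omega, hfi, hfj, fun k hik hkj => ⟨?_, ?_⟩⟩
  · rcases hik.lt_or_eq with h | h
    · linarith [himax k h (hkj.trans hjm)]
    · subst h
      by_contra hlt
      push Not at hlt
      have h1 := himax (i + 1) (Nat.lt_succ_self i) (by omega)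
      have h2 := (hst i (by omega) (by omega)).1
      linarith
  · rcases hkj.lt_or_eq with h | h
    · linarith [hjmin k hik h]
    · rw [h]
      by_contra hlt
      push Not at hlt
      have h1 := hjmin (j - 1) (by omega) (by omega)
      have h2 := (hst (j - 1) (by omega) (by omega)).1
      rw [Nat.sub_add_cancel (by omega)] at h2
      linarith

/-- **Passage extraction, inward direction** (`exists_passage` for `-f`): a sequence `> R` at `l`
and `< r` at `m` has indices `l < i ≤ j < m` with `R - δ < f i`, `f j < r + δ` and
`r ≤ f k ≤ R` in between. [folklore] -/
theorem exists_passage' {f : ℕ → ℝ} {δ r R : ℝ} (hδ : 0 < δ) (hrR : r + 2 * δ ≤ R) {l m : ℕ}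
    (hlm : l < m) (hstep : ∀ k, l ≤ k → k < m → |f (k + 1) - f k| ≤ δ) (hl : R < f l)
    (hm : f m < r) :
    ∃ i j : ℕ, l < i ∧ i ≤ j ∧ j < m ∧ R - δ < f i ∧ f j < r + δ ∧
      ∀ k, i ≤ k → k ≤ j → r ≤ f k ∧ f k ≤ R := by
  obtain ⟨i, j, h1, h2, h3, h4, h5, h6⟩ := exists_passage (f := fun k => -f k) (r := -R) (R := -r) hδ
    (by linarith) hlm (fun k hk hk' => by rw [← abs_neg]; convert hstep k hk hk' using 2; ring)
    (by simpa using hl) (by simpa using hm)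
  refine ⟨i, j, h1, h2, h3, by linarith, by linarith, fun k hk hk' => ?_⟩
  have := h6 k hk hk'
  constructor <;> linarith [this.1, this.2]

/-! ## §4 The far side of a collar: exit indices and the passage of a walk reaching it

Throughout, for collar data `(Λ, V, a, H)`: `Near` is the set of sites joined to `a` off the
collar `V` inside `Λ` and a site `y` is FAR when some `h ∈ H` is joined to `y` off the collar
(`∃ h ∈ H, (∃ p : (zdGraph 2).Walk y h, ∀ x ∈ p.support, x ∈ Λ ∧ x ∉ V)`; then `y ∈ Λ ∖ V`). -/

section Passage

variable {δ r R : ℝ} {Λ V H : Finset (Site 2)} {a b e : Site 2} {z₀ : ℂ}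

/-- A `Λ`-site off `Near` adjacent to a site of `Near` lies in the collar `V`. [folklore] -/
theorem mem_collar_of_adj_near {s₀ s₁ : Site 2} (hs₀ : s₀ ∈ Λ) (hs₀N : ¬ (∃ p : (zdGraph 2).Walk a s₀, ∀ x ∈ p.support, x ∈ Λ ∧ x ∉ V))
    (hadj : (zdGraph 2).Adj s₀ s₁) (hs₁N : (∃ p : (zdGraph 2).Walk a s₁, ∀ x ∈ p.support, x ∈ Λ ∧ x ∉ V)) : s₀ ∈ V := by
  by_contra hV
  exact hs₀N (joined_trans hs₁N (joined_of_adj (mem_of_joined_right hs₁N) ⟨hs₀, hV⟩ hadj.symm))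

/-- A `Λ`-site that is not far, adjacent to a far site, lies in the collar `V`. [folklore] -/
theorem mem_collar_of_adj_far {s₀ s₁ : Site 2} (hs₀ : s₀ ∈ Λ) (hs₀F : ¬ ∃ h ∈ H, (∃ p : (zdGraph 2).Walk s₀ h, ∀ x ∈ p.support, x ∈ Λ ∧ x ∉ V))
    (hadj : (zdGraph 2).Adj s₀ s₁) (hs₁F : ∃ h ∈ H, (∃ p : (zdGraph 2).Walk s₁ h, ∀ x ∈ p.support, x ∈ Λ ∧ x ∉ V)) : s₀ ∈ V := by
  by_contra hV
  obtain ⟨h, hh, hhs⟩ := hs₁F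
  exact hs₀F ⟨h, hh, joined_trans (joined_of_adj ⟨hs₀, hV⟩ (mem_of_joined_left hhs) hadj) hhs⟩

/-- A site of `H ∩ Λ` is far (the collar misses `H`). [folklore] -/
theorem far_of_mem (hVH : ∀ x ∈ V, x ∉ H) (he : e ∈ H) (heΛ : e ∈ Λ) : ∃ h ∈ H, (∃ p : (zdGraph 2).Walk e h, ∀ x ∈ p.support, x ∈ Λ ∧ x ∉ V) :=
  ⟨e, he, joined_refl ⟨heΛ, fun heV => hVH e heV he⟩⟩

/-- No site of `Near` is far (`H` misses `Near`). [folklore] -/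
theorem not_far_of_near (hNearH : ∀ y, (∃ p : (zdGraph 2).Walk a y, ∀ x ∈ p.support, x ∈ Λ ∧ x ∉ V) → y ∉ H) {y : Site 2} (hy : (∃ p : (zdGraph 2).Walk a y, ∀ x ∈ p.support, x ∈ Λ ∧ x ∉ V)) :
    ¬ ∃ h ∈ H, (∃ p : (zdGraph 2).Walk y h, ∀ x ∈ p.support, x ∈ Λ ∧ x ∉ V) := by
  rintro ⟨h, hh, hhy⟩
  exact hNearH h (joined_trans hy hhy) hh

/-- **Exit indices.** A `Λ`-walk `q` from `a` to a site `e ∈ H ∩ Λ` has a last visit `l` to `Near`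
before its first far site `m`: `q_l ∈ Near`, `q_{l+1}, q_{m-1} ∈ V`, `q_m` far, and the sites strictly
between `l` and `m` are neither in `Near` nor far. [folklore] -/
theorem exists_exit_indices (ha : a ∈ Λ ∧ a ∉ V) (hNearH : ∀ y, (∃ p : (zdGraph 2).Walk a y, ∀ x ∈ p.support, x ∈ Λ ∧ x ∉ V) → y ∉ H)
    (hVH : ∀ x ∈ V, x ∉ H) (he : e ∈ H) (q : (zdGraph 2).Walk a e) (hq : ∀ x ∈ q.support, x ∈ Λ) :
    ∃ l m : ℕ, l + 1 < m ∧ m ≤ q.length ∧ (∃ p : (zdGraph 2).Walk a (q.getVert l), ∀ x ∈ p.support, x ∈ Λ ∧ x ∉ V) ∧ q.getVert (l + 1) ∈ V ∧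
      (∃ h ∈ H, (∃ p : (zdGraph 2).Walk (q.getVert m) h, ∀ x ∈ p.support, x ∈ Λ ∧ x ∉ V)) ∧ q.getVert (m - 1) ∈ V ∧
      ∀ k, l < k → k < m → ¬ (∃ p : (zdGraph 2).Walk a (q.getVert k), ∀ x ∈ p.support, x ∈ Λ ∧ x ∉ V) ∧ ¬ ∃ h ∈ H, (∃ p : (zdGraph 2).Walk (q.getVert k) h, ∀ x ∈ p.support, x ∈ Λ ∧ x ∉ V) := by
  classical
  have hΛk : ∀ k, q.getVert k ∈ Λ := fun k => hq _ (q.getVert_mem_support k)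
  have hexF : ∃ k, ∃ h ∈ H, (∃ p : (zdGraph 2).Walk (q.getVert k) h, ∀ x ∈ p.support, x ∈ Λ ∧ x ∉ V) :=
    ⟨q.length, by rw [q.getVert_length]; exact far_of_mem hVH he (hq e q.end_mem_support)⟩
  set m := Nat.find hexF with hmdef
  have hmF : ∃ h ∈ H, (∃ p : (zdGraph 2).Walk (q.getVert m) h, ∀ x ∈ p.support, x ∈ Λ ∧ x ∉ V) := Nat.find_spec hexF
  have hmmin : ∀ k < m, ¬ ∃ h ∈ H, (∃ p : (zdGraph 2).Walk (q.getVert k) h, ∀ x ∈ p.support, x ∈ Λ ∧ x ∉ V) := fun k hk => Nat.find_min hexF hk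
  have hmlen : m ≤ q.length := Nat.find_min' hexF (by rw [q.getVert_length]; exact far_of_mem hVH he (hq e q.end_mem_support))
  have ha' : (∃ p : (zdGraph 2).Walk a a, ∀ x ∈ p.support, x ∈ Λ ∧ x ∉ V) := joined_refl ha
  have hm0 : m ≠ 0 := fun h0 => by
    have := hmF; rw [h0, q.getVert_zero] at this; exact not_far_of_near hNearH ha' this
  have hadjm : (zdGraph 2).Adj (q.getVert (m - 1)) (q.getVert m) := by
    have := q.adj_getVert_succ (i := m - 1) (by omega)
    rwa [Nat.sub_add_cancel (Nat.one_le_iff_ne_zero.2 hm0)] at this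
  have hVm : q.getVert (m - 1) ∈ V := mem_collar_of_adj_far (hΛk _) (hmmin _ (by omega)) hadjm hmF
  set l := Nat.findGreatest (fun k => (∃ p : (zdGraph 2).Walk a (q.getVert k), ∀ x ∈ p.support, x ∈ Λ ∧ x ∉ V)) (m - 1) with hldef
  have hlN : (∃ p : (zdGraph 2).Walk a (q.getVert l), ∀ x ∈ p.support, x ∈ Λ ∧ x ∉ V) :=
    Nat.findGreatest_spec (P := fun k => (∃ p : (zdGraph 2).Walk a (q.getVert k), ∀ x ∈ p.support, x ∈ Λ ∧ x ∉ V)) (Nat.zero_le _) (by rw [q.getVert_zero]; exact ha')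
  have hlm : l ≤ m - 1 := Nat.findGreatest_le (m - 1)
  have hlmax : ∀ k, l < k → k ≤ m - 1 → ¬ (∃ p : (zdGraph 2).Walk a (q.getVert k), ∀ x ∈ p.support, x ∈ Λ ∧ x ∉ V) := fun k hk hkm =>
    Nat.findGreatest_is_greatest hk hkm
  have hlm' : l ≠ m - 1 := fun h => by rw [h] at hlN; exact (mem_of_joined_right hlN).2 hVm
  have hVl : q.getVert (l + 1) ∈ V :=
    mem_collar_of_adj_near (hΛk _) (hlmax _ (Nat.lt_succ_self l) (by omega)) (q.adj_getVert_succ (i := l) (by omega)).symm hlN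
  refine ⟨l, m, by omega, hmlen, hlN, hVl, hmF, hVm, fun k hk hkm => ⟨hlmax k hk (by omega), hmmin k hkm⟩⟩

/-- **The passage `q[i, j]` is avoidable**: if `q_i, …, q_j` lie in the closed annulus, off `Near`
and not far, and `Λ ∖ (Near ∪ Far)` is closed under lattice adjacency inside the annulus, then no
site joined inside `Λ ∩` annulus to a site of `q[i, j]` lies on the near walk `p₀`. [folklore] -/
theorem passage_of_indices (p₀ : (zdGraph 2).Walk a b) (hp₀ : ∀ x ∈ p₀.support, x ∈ Λ ∧ x ∉ V)
    (hclosed : ∀ s₀ s₁ : Site 2, s₀ ∈ Λ → ¬ (∃ p : (zdGraph 2).Walk a s₀, ∀ x ∈ p.support, x ∈ Λ ∧ x ∉ V) → (¬ ∃ h ∈ H, (∃ p : (zdGraph 2).Walk s₀ h, ∀ x ∈ p.support, x ∈ Λ ∧ x ∉ V)) →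
      (zdGraph 2).Adj s₀ s₁ → s₁ ∈ Λ → r ≤ dist (meshPoint δ s₁) z₀ → dist (meshPoint δ s₁) z₀ ≤ R →
      ¬ (∃ p : (zdGraph 2).Walk a s₁, ∀ x ∈ p.support, x ∈ Λ ∧ x ∉ V) ∧ ¬ ∃ h ∈ H, (∃ p : (zdGraph 2).Walk s₁ h, ∀ x ∈ p.support, x ∈ Λ ∧ x ∉ V))
    (q : (zdGraph 2).Walk a e) (hq : ∀ x ∈ q.support, x ∈ Λ) {i j : ℕ} (hij : i ≤ j)
    (hrad : ∀ k, i ≤ k → k ≤ j →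
      r ≤ dist (meshPoint δ (q.getVert k)) z₀ ∧ dist (meshPoint δ (q.getVert k)) z₀ ≤ R)
    (hC : ∀ k, i ≤ k → k ≤ j → ¬ (∃ p : (zdGraph 2).Walk a (q.getVert k), ∀ x ∈ p.support, x ∈ Λ ∧ x ∉ V) ∧ ¬ ∃ h ∈ H, (∃ p : (zdGraph 2).Walk (q.getVert k) h, ∀ x ∈ p.support, x ∈ Λ ∧ x ∉ V)) :
    ∀ x ∈ ((q.drop i).take (j - i)).support, x ∈ Λ ∧ r ≤ dist (meshPoint δ x) z₀ ∧
      dist (meshPoint δ x) z₀ ≤ R ∧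
      ∃ p : (zdGraph 2).Walk a b, ∀ y ∈ p.support, y ∈ Λ ∧
        ¬ ∃ t : (zdGraph 2).Walk x y, ∀ s ∈ t.support,
          s ∈ Λ ∧ r ≤ dist (meshPoint δ s) z₀ ∧ dist (meshPoint δ s) z₀ ≤ R := by
  intro x hx
  obtain ⟨t, ht, -⟩ := Walk.mem_support_iff_exists_getVert.1 hx
  rw [Walk.take_getVert, Walk.drop_getVert] at ht
  set k := i + min (j - i) t with hkdef
  have hik : i ≤ k := Nat.le_add_right _ _
  have hkj : k ≤ j := by have := min_le_left (j - i) t; omega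
  rw [← ht]
  have hxΛ : q.getVert k ∈ Λ := hq _ (q.getVert_mem_support k)
  refine ⟨hxΛ, (hrad k hik hkj).1, (hrad k hik hkj).2, p₀, fun y hy => ⟨(hp₀ y hy).1, ?_⟩⟩
  rintro ⟨w, hw⟩
  have key : ∀ (x' y' : Site 2) (w' : (zdGraph 2).Walk x' y'), x' ∈ Λ → ¬ (∃ p : (zdGraph 2).Walk a x', ∀ x ∈ p.support, x ∈ Λ ∧ x ∉ V) →
      (¬ ∃ h ∈ H, (∃ p : (zdGraph 2).Walk x' h, ∀ x ∈ p.support, x ∈ Λ ∧ x ∉ V)) →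
      (∀ s ∈ w'.support, s ∈ Λ ∧ r ≤ dist (meshPoint δ s) z₀ ∧ dist (meshPoint δ s) z₀ ≤ R) →
      ¬ (∃ p : (zdGraph 2).Walk a y', ∀ x ∈ p.support, x ∈ Λ ∧ x ∉ V) := by
    intro x' y' w'
    induction w' with
    | nil => exact fun _ h _ _ => h
    | cons hadj w'' ih =>
      rename_i u₀ u₁ _
      intro hu₀ hu₀N hu₀F hs
      have hu₁ := hs u₁ (by rw [Walk.support_cons]; exact List.mem_cons_of_mem _ w''.start_mem_support)
      have h₁ := hclosed u₀ u₁ hu₀ hu₀N hu₀F hadj hu₁.1 hu₁.2.1 hu₁.2.2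
      exact ih hu₁.1 h₁.1 h₁.2 fun s hs' => hs s (by rw [Walk.support_cons]; exact List.mem_cons_of_mem _ hs')
  exact key _ _ w hxΛ (hC k hik hkj).1 (hC k hik hkj).2 hw (joined_of_mem_support p₀ hp₀ hy)

/-- **Every `Λ`-walk from `a` into `H` contains an unforced crossing of the collar annulus**: under
the collar clauses of the registered signature (either disjunct) and `r + 2δ ≤ R`, a lattice walk in
`Λ` from `a` to a site of `H` has a sub-walk from within `δ` of one circle of `r ≤ |δx - z₀| ≤ R` to
within `δ` of the other whose sites lie in `Λ ∩` annulus and are not joined inside `Λ ∩` annulus to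
the walk from `a` to `b` off the collar (AVOIDABLE, Kemppainen–Smirnov 2017, Def. 2.2). [folklore] -/
theorem exists_unforced_passage (hδ : 0 < δ) (hrR : r + 2 * δ ≤ R)
    (p₀ : (zdGraph 2).Walk a b) (hp₀ : ∀ x ∈ p₀.support, x ∈ Λ ∧ x ∉ V)
    (hNearH : ∀ y, (∃ p : (zdGraph 2).Walk a y, ∀ x ∈ p.support, x ∈ Λ ∧ x ∉ V) → y ∉ H)
    (hVH : ∀ x ∈ V, x ∉ H)
    (hdisj : (∀ x ∈ V, ∀ y ∈ Λ, y ∉ V → (zdGraph 2).Adj x y →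
            ((∃ p : (zdGraph 2).Walk a y, ∀ x ∈ p.support, x ∈ Λ ∧ x ∉ V) →
              dist (meshPoint δ y) z₀ < r) ∧
            ((∃ h ∈ H, (∃ p : (zdGraph 2).Walk y h, ∀ x ∈ p.support, x ∈ Λ ∧ x ∉ V)) →
              R < dist (meshPoint δ y) z₀)) ∨
         (∀ x ∈ V, ∀ y ∈ Λ, y ∉ V → (zdGraph 2).Adj x y →
            ((∃ p : (zdGraph 2).Walk a y, ∀ x ∈ p.support, x ∈ Λ ∧ x ∉ V) →
              R < dist (meshPoint δ y) z₀) ∧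
            ((∃ h ∈ H, (∃ p : (zdGraph 2).Walk y h, ∀ x ∈ p.support, x ∈ Λ ∧ x ∉ V)) →
              dist (meshPoint δ y) z₀ < r)))
    (he : e ∈ H) (q : (zdGraph 2).Walk a e) (hq : ∀ x ∈ q.support, x ∈ Λ) :
    ∃ (u v : Site 2) (c : (zdGraph 2).Walk u v), c.IsSubwalk q ∧
      ((dist (meshPoint δ u) z₀ < r + δ ∧ R - δ < dist (meshPoint δ v) z₀) ∨
       (R - δ < dist (meshPoint δ u) z₀ ∧ dist (meshPoint δ v) z₀ < r + δ)) ∧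
      ∀ x ∈ c.support, x ∈ Λ ∧ r ≤ dist (meshPoint δ x) z₀ ∧ dist (meshPoint δ x) z₀ ≤ R ∧
        ∃ p : (zdGraph 2).Walk a b, ∀ y ∈ p.support, y ∈ Λ ∧
          ¬ ∃ t : (zdGraph 2).Walk x y, ∀ s ∈ t.support,
              s ∈ Λ ∧ r ≤ dist (meshPoint δ s) z₀ ∧ dist (meshPoint δ s) z₀ ≤ R := by
  have ha : a ∈ Λ ∧ a ∉ V := hp₀ a p₀.start_mem_support
  obtain ⟨l, m, hlm, hmlen, hlN, hVl, hmF, hVm, hmid⟩ := exists_exit_indices ha hNearH hVH he q hq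
  have hΛk : ∀ k, q.getVert k ∈ Λ := fun k => hq _ (q.getVert_mem_support k)
  set f : ℕ → ℝ := fun k => dist (meshPoint δ (q.getVert k)) z₀ with hf
  have hstep : ∀ k, l ≤ k → k < m → |f (k + 1) - f k| ≤ δ := fun k _ hk =>
    abs_dist_sub_dist_le_of_adj hδ z₀ (q.adj_getVert_succ (i := k) (by omega))
  have hadjl : (zdGraph 2).Adj (q.getVert (l + 1)) (q.getVert l) := (q.adj_getVert_succ (i := l) (by omega)).symm
  have hadjm : (zdGraph 2).Adj (q.getVert (m - 1)) (q.getVert m) := by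
    have := q.adj_getVert_succ (i := m - 1) (by omega)
    rwa [Nat.sub_add_cancel (by omega)] at this
  have hlΛV := mem_of_joined_right hlN
  obtain ⟨h₀, hh₀, hh₀m⟩ := hmF
  have hmΛV := mem_of_joined_left hh₀m
  -- the case data: passage indices, radii, direction, and closure of the middle region
  obtain ⟨i, j, hli, hij, hjm, hrad, hdir, hclosed⟩ : ∃ i j : ℕ, l < i ∧ i ≤ j ∧ j < m ∧
      (∀ k, i ≤ k → k ≤ j → r ≤ f k ∧ f k ≤ R) ∧
      ((f i < r + δ ∧ R - δ < f j) ∨ (R - δ < f i ∧ f j < r + δ)) ∧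
      (∀ s₀ s₁ : Site 2, s₀ ∈ Λ → (¬ ∃ p : (zdGraph 2).Walk a s₀, ∀ x ∈ p.support, x ∈ Λ ∧ x ∉ V) →
        (¬ ∃ h ∈ H, ∃ p : (zdGraph 2).Walk s₀ h, ∀ x ∈ p.support, x ∈ Λ ∧ x ∉ V) →
        (zdGraph 2).Adj s₀ s₁ → s₁ ∈ Λ → r ≤ dist (meshPoint δ s₁) z₀ → dist (meshPoint δ s₁) z₀ ≤ R →
        (¬ ∃ p : (zdGraph 2).Walk a s₁, ∀ x ∈ p.support, x ∈ Λ ∧ x ∉ V) ∧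
          ¬ ∃ h ∈ H, ∃ p : (zdGraph 2).Walk s₁ h, ∀ x ∈ p.support, x ∈ Λ ∧ x ∉ V) := by
    rcases hdisj with hcl | hcl
    · -- first disjunct: `Near` inside, far side outside
      have hl : f l < r := (hcl _ hVl _ hlΛV.1 hlΛV.2 hadjl).1 hlN
      have hm : R < f m := (hcl _ hVm _ hmΛV.1 hmΛV.2 hadjm).2 ⟨h₀, hh₀, hh₀m⟩
      obtain ⟨i, j, hli, hij, hjm, hfi, hfj, hrad⟩ := exists_passage hδ hrR (by omega : l < m) hstep hl hm
      refine ⟨i, j, hli, hij, hjm, hrad, Or.inl ⟨hfi, hfj⟩,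
        fun s₀ s₁ hs₀ hs₀N hs₀F hadj hs₁ hr₁ hR₁ => ⟨fun hs₁N => ?_, fun hs₁F => ?_⟩⟩
      · have := (hcl s₀ (mem_collar_of_adj_near hs₀ hs₀N hadj hs₁N) s₁ hs₁ (mem_of_joined_right hs₁N).2
          hadj).1 hs₁N
        linarith
      · obtain ⟨h, hh, hhs⟩ := hs₁F
        have := (hcl s₀ (mem_collar_of_adj_far hs₀ hs₀F hadj ⟨h, hh, hhs⟩) s₁ hs₁
          (mem_of_joined_left hhs).2 hadj).2 ⟨h, hh, hhs⟩
        linarith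
    · -- second disjunct: `Near` outside, far side inside
      have hl : R < f l := (hcl _ hVl _ hlΛV.1 hlΛV.2 hadjl).1 hlN
      have hm : f m < r := (hcl _ hVm _ hmΛV.1 hmΛV.2 hadjm).2 ⟨h₀, hh₀, hh₀m⟩
      obtain ⟨i, j, hli, hij, hjm, hfi, hfj, hrad⟩ := exists_passage' hδ hrR (by omega : l < m) hstep hl hm
      refine ⟨i, j, hli, hij, hjm, hrad, Or.inr ⟨hfi, hfj⟩,
        fun s₀ s₁ hs₀ hs₀N hs₀F hadj hs₁ hr₁ hR₁ => ⟨fun hs₁N => ?_, fun hs₁F => ?_⟩⟩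
      · have := (hcl s₀ (mem_collar_of_adj_near hs₀ hs₀N hadj hs₁N) s₁ hs₁ (mem_of_joined_right hs₁N).2
          hadj).1 hs₁N
        linarith
      · obtain ⟨h, hh, hhs⟩ := hs₁F
        have := (hcl s₀ (mem_collar_of_adj_far hs₀ hs₀F hadj ⟨h, hh, hhs⟩) s₁ hs₁
          (mem_of_joined_left hhs).2 hadj).2 ⟨h, hh, hhs⟩
        linarith
  refine ⟨q.getVert i, (q.drop i).getVert (j - i), (q.drop i).take (j - i),
    ((q.drop i).isSubwalk_take (j - i)).trans (q.isSubwalk_drop i), ?_,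
    passage_of_indices p₀ hp₀ hclosed q hq hij hrad fun k hk hk' => hmid k (by omega) (by omega)⟩
  have hv : (q.drop i).getVert (j - i) = q.getVert j := by
    rw [Walk.drop_getVert]; congr 1; omega
  rw [hv]
  exact hdir

end Passage

/-- **Worker sub-goal `stub_killedWalkUnforcedPassage`** of stub `stub_killedWalkCollarBound` (registered,
def-free): `exists_unforced_passage` in closed form — under the collar clauses, every lattice walk in `Λ`
from `a` to a site of `H` contains an avoidable crossing of the collar annulus. [folklore] -/
theorem stub_killedWalkUnforcedPassage :
    ∀ (δ r R : ℝ) (Λ V H : Finset (Site 2)) (a b e : Site 2) (z₀ : ℂ), 0 < δ → r + 2 * δ ≤ R → ∀ (p₀ :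
    (zdGraph 2).Walk a b), (∀ x ∈ p₀.support, x ∈ Λ ∧ x ∉ V) → (∀ y, (∃ p : (zdGraph 2).Walk a y, ∀ x ∈
    p.support, x ∈ Λ ∧ x ∉ V) → y ∉ H) → (∀ x ∈ V, x ∉ H) → ((∀ x ∈ V, ∀ y ∈ Λ, y ∉ V → (zdGraph 2).Adj x y
    → ((∃ p : (zdGraph 2).Walk a y, ∀ x ∈ p.support, x ∈ Λ ∧ x ∉ V) → dist (meshPoint δ y) z₀ < r) ∧ ((∃ h ∈
    H, (∃ p : (zdGraph 2).Walk y h, ∀ x ∈ p.support, x ∈ Λ ∧ x ∉ V)) → R < dist (meshPoint δ y) z₀)) ∨ (∀ x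
    ∈ V, ∀ y ∈ Λ, y ∉ V → (zdGraph 2).Adj x y → ((∃ p : (zdGraph 2).Walk a y, ∀ x ∈ p.support, x ∈ Λ ∧ x ∉
    V) → R < dist (meshPoint δ y) z₀) ∧ ((∃ h ∈ H, (∃ p : (zdGraph 2).Walk y h, ∀ x ∈ p.support, x ∈ Λ ∧ x ∉
    V)) → dist (meshPoint δ y) z₀ < r))) → e ∈ H → ∀ (q : (zdGraph 2).Walk a e), (∀ x ∈ q.support, x ∈ Λ) →
    ∃ (u v : Site 2) (c : (zdGraph 2).Walk u v), c.IsSubwalk q ∧ ((dist (meshPoint δ u) z₀ < r + δ ∧ R - δ <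
    dist (meshPoint δ v) z₀) ∨ (R - δ < dist (meshPoint δ u) z₀ ∧ dist (meshPoint δ v) z₀ < r + δ)) ∧ ∀ x ∈
    c.support, x ∈ Λ ∧ r ≤ dist (meshPoint δ x) z₀ ∧ dist (meshPoint δ x) z₀ ≤ R ∧ ∃ p : (zdGraph 2).Walk a
    b, ∀ y ∈ p.support, y ∈ Λ ∧ ¬ ∃ t : (zdGraph 2).Walk x y, ∀ s ∈ t.support, s ∈ Λ ∧ r ≤ dist (meshPoint δ
    s) z₀ ∧ dist (meshPoint δ s) z₀ ≤ R :=
  fun _ _ _ _ _ _ _ _ _ _ hδ hrR p₀ hp₀ hNearH hVH hdisj he q hq =>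
    exists_unforced_passage hδ hrR p₀ hp₀ hNearH hVH hdisj he q hq

end Summit.CriticalPhenomena.SAWScalingLimit.Theorems.FKGToTraversalBound.ExcursionDomination.KilledWalkCollar
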